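import Literature.MathematicalPhysics.QuantumFieldTheory.Balaban1983to89.Beta.WilsonVertexKron
import Literature.MathematicalPhysics.QuantumFieldTheory.Balaban1983to89.Beta.PlaquetteVertex2Words

/-!
# The Wilson `(2,2)`-jet RE-INDEXED BY BACKGROUND BOND PAIRS: the two-bond second-order vertex as a Kronecker / colourless
# stencil per colour word — the second-order half of the an3 Wilson-jet instance

HONEST FRAMING (cell `pub-balaban`, β sub-cell, lineage an3; verbatim): discharging `BetaPertH` makes Bałaban's UV stability
UNCONDITIONAL — a real constructive-QFT result; it is NOT the continuum limit and NOT the Clay problem.  This file discharges NOTHING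
of `BetaPertH`.  ABSOLUTE RULE of the cell (verbatim): «No internally-minted statement may enter as a cited fact. Every hypothesis is
either kernel-proved in this package or a verbatim quotation of a PUBLISHED theorem with page reference. The manuscript(s) under audit
are NOT citable for their own disputed steps — they are the thing under adjudication; programme-internal (2001/route/tribunal) claims
are never citable.»  Accordingly every declaration below is a definition or is kernel-proved here from the imports; NOTHING is cited;
no `def … : Prop` carries a citation; B9/B12 are not even context here.

WHAT THIS FILE IS.  The landed leaves `PlaquetteVertex2Polar` / `…Words` / `…Stencil` give the `(2,2)`-jet of the Wilson action per
PLAQUETTE: base point `x`, directions `(μ, ν)`, four positions `i, j` (fluctuation slots) and `k, l` (background slots), with the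
position–colour kernel `K22 τ t i j k l a b c d` written as nine colour words times signed, gated position tables, and ONE traced
weight per word in Bałaban's letters (`w22 N`).  The composite-step operator of the β sub-cell (`OneStepResolventKernel.JetData`,
field `W μ y ν y'`, an2's node JCREC) wants the SAME object indexed the other way round: for an ORDERED PAIR of background
coordinates `p₁ = (u₁,(c,κ₁))`, `p₂ = (u₂,(d,κ₂))` the finite matrix on `Λ × (C × D)` multiplying `u p₁ · u p₂` in the `B`-Hessian.
This file performs exactly that re-indexing, kernel-checked, and nothing else.

CONTENT (all `[folklore]`; §4 and the contact identities of §5 on a finite torus, the rest on any additive lattice `Λ`):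
* §1 `cwordV τ t Y Y' a b : Fin 9 → ℝ` (the nine colour words as ONE family), `cmat τ t w c d : Matrix C C ℝ`, the signed gated
  position tables `stab i j k l : Fin 9 → ℝ`, the weights `kap N : Fin 9 → ℝ`; `K22 = Σ_w stab_w · cwordV_w` (`K22_eq_sum_words`,
  from `PlaquetteVertex2Words.K22_eq_words`), `w22 N = Σ_w kap_w · stab_w` (`w22_eq_sum_kap`), and in Bałaban's letters
  `trace (cmat rntr (gen τ) w c d) = [c = d]·kap N w` (`trace_cmat_gen`, from the nine landed diagonal sums).
* §2 `cell`, `bondPairMat e u₁ κ₁ u₂ κ₂ M := Σ_{μ,ν} Σ_{k,l} [dir k = κ₁ ∧ dir l = κ₂ ∧ u₁ − off k + off l = u₂] · plaqMat e (u₁ − off k) μ ν (M · · k l)`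
  (every plaquette cell whose position `k` carries the bond `⟨u₁,κ₁⟩` and whose position `l` carries `⟨u₂,κ₂⟩`), the colourless
  `plaqTab` / `cellTab` / `bondPairTab` on `Λ × D`, the Kronecker kernels `kronK T A := (A a b · T i j k l)`; the ENTRYWISE KRONECKER
  READING `bondPairMat (kronK T A) (y,(a,α)) (y′,(b,β)) = A a b · bondPairTab T (y,α) (y′,β)` and its `C := Unit, A := 1` form.
* §3 linearity of `plaqMat` / `bondPairMat` in the kernel; `K22ker`, **`wilsonVertex₂ τ t e p₁ p₂`**; the WORD DECOMPOSITION
  `wilsonVertex₂ = Σ_w bondPairMat (kronK stab_w (cmat_w (c,d)))` and its entrywise form.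
* §4 HEADLINE (finite torus): `hess22 τ t e (field t u) = Σ_{p₁} Σ_{p₂} (u p₁ · u p₂) • wilsonVertex₂ τ t e p₁ p₂`
  (`hess22_field_eq_sum_wilsonVertex₂`; any algebra, any real-linear `τ`, any letters), hence
  `jet22 ℝ τ e (field t v) (field t u) = Σ_{p₁,p₂} u p₁ u p₂ (v ⬝ wilsonVertex₂ p₁ p₂ v)` for tracial `τ`; the re-indexing lemmas
  `reindex_cell` / `reindex_bondPairs` are stated for any real vector space of values.
* §5 SOCKETS: finite range (rows / columns), co-plaquette support, translation covariance — for `bondPairMat` and `bondPairTab`;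
  linearity of `bondPairTab`, `bondPairTab (w22 N) = Σ_w kap_w • bondPairTab stab_w`; the COLOUR-BLIND CONTACT FACTORISATION
  `trace ((1 ⊗ G)-legs · bondPairMat (kronK T A)) = trace A · trace (G-legs · bondPairTab T)` and, in Bałaban's letters,
  `trace ((1 ⊗ G)-legs · wilsonVertex₂ rntr (gen τ) e p₁ p₂) = [c = d] · trace (G-legs · bondPairTab (w22 N))`.
* §6 kernel-checked examples.

FOR an2 (reading, not a claim about an2's file): on `Λ = ℤ^{d+1}`, `C := Unit`, the colourless second-order stencil of the word `w`
through the bonds `⟨u,κ⟩`, `⟨u′,κ′⟩` is `bondPairTab e u κ u′ κ′ (fun i j k l => stab i j k l w)`, equivalently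
`bondPairMat (C := Unit) e u κ u′ κ′ (kronK (stab · · · · w) 1)` read at `((x,((),α)), (z,((),β)))` (`bondPairTab_apply_eq_unit`);
its colour factor is `cmat τ t w c d`, whose trace in Bałaban's letters is `[c = d]·kap N w`.

NOT PROVED, NOT CLAIMED: any bound, any localisation constant, any statement about `BetaPertH`, `D1Drift`, the RG flow or the
continuum limit; the symmetric / antisymmetric splitting of the second-order vertex under `p₁ ↔ p₂` is not performed here (the
ordered-pair form is what the Hessian identity §4 states); GAPS entry C-beta-an3-37 records what this leaf does not do.
-/

noncomputable section

namespace Literature.MathematicalPhysics.QuantumFieldTheory.Balaban1983to89.Beta.WilsonVertex2Kron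

open Finset
open scoped BigOperators Matrix Kronecker
open Literature.MathematicalPhysics.QuantumFieldTheory.Balaban1983to89.Beta.BubbleTable (elemIns elemIns_apply stencilIns mconvKernel
  contact_stencil_m)
open Literature.MathematicalPhysics.QuantumFieldTheory.Balaban1983to89.Beta.PlaquetteStencil (dirBlock dirBlock_apply)
open Literature.MathematicalPhysics.QuantumFieldTheory.Balaban1983to89.Beta.PlaquetteStencilData (stencilIns_apply
  stencilIns_apply_eq_zero_of_row stencilIns_apply_eq_zero_of_col stencilIns_translate)
open Literature.MathematicalPhysics.QuantumFieldTheory.Balaban1983to89.Beta.ColourTrace (Complete TrOrthonormal)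
open Literature.MathematicalPhysics.QuantumFieldTheory.Balaban1983to89.Beta.PlaquetteVertex (rntr gen field)
open Literature.MathematicalPhysics.QuantumFieldTheory.Balaban1983to89.Beta.PlaquetteVertex2 (jet22)
open Literature.MathematicalPhysics.QuantumFieldTheory.Balaban1983to89.Beta.PlaquetteVertex2Coords (sgn cv)
open Literature.MathematicalPhysics.QuantumFieldTheory.Balaban1983to89.Beta.PlaquetteVertex2Polar (K22 jet22_field_field)
open Literature.MathematicalPhysics.QuantumFieldTheory.Balaban1983to89.Beta.PlaquetteVertex2Trace (w22)
open Literature.MathematicalPhysics.QuantumFieldTheory.Balaban1983to89.Beta.PlaquetteVertex2Stencil (dir off cv_eq blk plaqMat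
  plaqMat_apply_eq_zero_of_row plaqMat_apply_eq_zero_of_col plaqMat_translate dotProduct_plaqMat_mulVec cbLeg trace_mconvKernel_mul_plaqMat
  trace_cbLeg_mul_dirBlock)
open Literature.MathematicalPhysics.QuantumFieldTheory.Balaban1983to89.Beta.PlaquetteVertex2Words
open Literature.MathematicalPhysics.QuantumFieldTheory.Balaban1983to89.Beta.WilsonVertexKron (dirBlock_eq_kronecker cbLeg_eq_kronecker
  trace_kronLeg_mul)

/-! ## §1 The nine colour words as one family; signed, gated position tables; the traced weights -/

section Words

variable {𝔸 : Type*} [NormedRing 𝔸] [NormedAlgebra ℝ 𝔸] {C : Type*}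

/-- **THE NINE COLOUR WORDS AS ONE `Fin 9`-FAMILY** (order: seagull, transport, accumulated commutator, scalar slot, right spin, left spin,
pair scalar, pair left spin, pair right spin — the words of `PlaquetteVertex2Words` §1, each with its `½`). [folklore] -/
def cwordV (τ : 𝔸 →ₗ[ℝ] ℝ) (t : C → 𝔸) (Y Y' : 𝔸) (a b : C) : Fin 9 → ℝ :=
  ![cwSeagull τ t Y Y' a b, cwTrans τ t Y Y' a b, cwAcc τ t Y Y' a b, cwScalar τ t Y Y' a b, cwSpinR τ t Y Y' a b,
    cwSpinL τ t Y Y' a b, pwScalar τ t Y Y' a b, pwSpinL τ t Y Y' a b, pwSpinR τ t Y Y' a b]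

/-- THE COLOUR MATRIX OF WORD `w` at background letters `t_c, t_d`: `(a, b) ↦ cwordV τ t (t c) (t d) a b w`. [folklore] -/
def cmat (τ : 𝔸 →ₗ[ℝ] ℝ) (t : C → 𝔸) (w : Fin 9) (c d : C) : Matrix C C ℝ :=
  Matrix.of fun a b => cwordV τ t (t c) (t d) a b w

end Words

section Tables

/-- the PAIR GATE `[i < j]` of the pair words. [folklore] -/
def gate (i j : Fin 4) : ℝ := if i < j then 1 else 0

/-- **THE SIGNED, GATED POSITION TABLE OF EACH WORD**: `stab i j k l w = s_i s_j · t_w(i,j,k,l)` for the six symmetric-block words and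
`s_i s_j · [i<j] · t_w(i,j,k,l)` for the three pair words (`N`-free rationals). [folklore] -/
def stab (i j k l : Fin 4) : Fin 9 → ℝ :=
  ![sgn i * sgn j * tSeagull i j k l, sgn i * sgn j * tTrans i j k l, sgn i * sgn j * tAcc i j k l, sgn i * sgn j * tScalar i j k l,
    sgn i * sgn j * tSpinR i j k l, sgn i * sgn j * tSpinL i j k l, sgn i * sgn j * gate i j * tScalar i j k l,
    sgn i * sgn j * gate i j * tSpinL i j k l, sgn i * sgn j * gate i j * tSpinR i j k l]

/-- **THE TRACED WEIGHTS** `κ(N) = (−N², N², 0, ½(N²−1), −½N², ½N², 0, N², −N²)` (the per-word colour traces of `PlaquetteVertex2Words` §3,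
as one family). [folklore] -/
def kap (N : ℕ) : Fin 9 → ℝ :=
  ![-((N : ℝ) ^ 2), (N : ℝ) ^ 2, 0, 2⁻¹ * ((N : ℝ) ^ 2 - 1), -(2⁻¹ * (N : ℝ) ^ 2), 2⁻¹ * (N : ℝ) ^ 2, 0, (N : ℝ) ^ 2, -((N : ℝ) ^ 2)]

end Tables

section Decomposition

variable {𝔸 : Type*} [NormedRing 𝔸] [NormedAlgebra ℝ 𝔸] {C : Type*}

/-- **THE POLARISED KERNEL AS `Σ_w stab_w · cword_w`** (`PlaquetteVertex2Words.K22_eq_words` summed over the word index). [folklore] -/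
theorem K22_eq_sum_words (τ : 𝔸 →ₗ[ℝ] ℝ) (t : C → 𝔸) (i j k l : Fin 4) (a b c d : C) :
    K22 τ t i j k l a b c d = ∑ w, stab i j k l w * cwordV τ t (t c) (t d) a b w := by
  rw [K22_eq_words]
  simp only [Fin.sum_univ_succ, Fin.sum_univ_zero, stab, cwordV, gate, Matrix.cons_val_zero, Matrix.cons_val_succ]
  split_ifs <;> simp <;> ring

/-- the same, entry of the colour matrices. [folklore] -/
theorem K22_eq_sum_cmat (τ : 𝔸 →ₗ[ℝ] ℝ) (t : C → 𝔸) (i j k l : Fin 4) (a b c d : C) :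
    K22 τ t i j k l a b c d = ∑ w, stab i j k l w * cmat τ t w c d a b := by
  simp only [cmat, Matrix.of_apply, K22_eq_sum_words]

/-- **THE PRE-SUMMED TABLE AS `Σ_w κ_w · stab_w`** (`PlaquetteVertex2Words.w22_eq_weights`). [folklore] -/
theorem w22_eq_sum_kap (N : ℕ) (i j k l : Fin 4) : w22 N i j k l = ∑ w, kap N w * stab i j k l w := by
  rw [w22_eq_weights]
  simp only [Fin.sum_univ_succ, Fin.sum_univ_zero, stab, kap, gate, Matrix.cons_val_zero, Matrix.cons_val_succ]
  split_ifs <;> simp <;> ring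

end Decomposition

section Weights

attribute [local instance] Matrix.linftyOpNormedRing Matrix.linftyOpNormedAlgebra

variable {N : ℕ} {C : Type*} [Fintype C] [DecidableEq C]

/-- **ONE TRACED WEIGHT PER WORD, AS A FAMILY**: in Bałaban's letters, `Σ_a cwordV rntr (gen τ) (gen τ c) (gen τ d) a a w = [c = d]·κ_w(N)`
(the nine sums of `PlaquetteVertex2Words` §3 BY NAME). [folklore] -/
theorem sum_cwordV_diag {τ : C → Matrix (Fin N) (Fin N) ℂ} (hτ : Complete τ) (ho : TrOrthonormal τ) (hN : N ≠ 0) (c d : C)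
    (w : Fin 9) : ∑ a, cwordV rntr (gen τ) (gen τ c) (gen τ d) a a w = if c = d then kap N w else 0 := by
  fin_cases w
  · simpa [cwordV, kap] using sum_cwSeagull_diag hτ ho hN c d
  · simpa [cwordV, kap] using sum_cwTrans_diag hτ ho hN c d
  · simp [cwordV, kap, sum_cwAcc_diag]
  · simpa [cwordV, kap] using sum_cwScalar_diag hτ ho hN c d
  · simpa [cwordV, kap] using sum_cwSpinR_diag hτ ho hN c d
  · simpa [cwordV, kap] using sum_cwSpinL_diag hτ ho hN c d
  · simp [cwordV, kap, sum_pwScalar_diag]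
  · simpa [cwordV, kap] using sum_pwSpinL_diag hτ ho hN c d
  · simpa [cwordV, kap] using sum_pwSpinR_diag hτ ho hN c d

/-- **THE COLOUR TRACE OF THE WORD MATRIX**: `trace (cmat rntr (gen τ) w c d) = [c = d]·κ_w(N)`. [folklore] -/
theorem trace_cmat_gen {τ : C → Matrix (Fin N) (Fin N) ℂ} (hτ : Complete τ) (ho : TrOrthonormal τ) (hN : N ≠ 0) (w : Fin 9)
    (c d : C) : Matrix.trace (cmat rntr (gen τ) w c d) = if c = d then kap N w else 0 := by
  rw [← sum_cwordV_diag hτ ho hN c d w, Matrix.trace]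
  rfl

end Weights

/-! ## §2 The two-bond vertex: every plaquette cell through a given ordered pair of background bonds -/

section TwoBond

variable {Λ : Type*} [DecidableEq Λ] [AddCommGroup Λ] {C : Type*} {D : Type*} [Fintype D] [DecidableEq D]

omit [Fintype D] in
/-- ENTRIES OF THE PLAQUETTE STENCIL: `plaqMat e x μ ν M (y,(a,α)) (y′,(b,β)) = Σ_i Σ_j [y = x + off i ∧ y′ = x + off j]·[α = dir i ∧ β = dir j]·M i j a b`.
[folklore] -/
theorem plaqMat_apply (e : D → Λ) (x : Λ) (μ ν : D) (M : Fin 4 → Fin 4 → C → C → ℝ) (y y' : Λ) (a b : C) (α β : D) :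
    plaqMat e x μ ν M (y, (a, α)) (y', (b, β))
      = ∑ i, ∑ j, if y = x + off e μ ν i ∧ y' = x + off e μ ν j then (if α = dir μ ν i ∧ β = dir μ ν j then M i j a b else 0) else 0 := by
  rw [plaqMat, stencilIns_apply, Fintype.sum_prod_type]
  simp only [blk, dirBlock_apply, Matrix.of_apply]

/-- THE CELL of the plaquette `p_{μν}` whose position `k` is the bond `(u₁, κ₁)` and whose position `l` is the bond `(u₂, κ₂)` (base point
`u₁ − off k`; the zero matrix when there is no such plaquette), carrying the fluctuation kernel `M · · k l`. [folklore] -/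
def cell (e : D → Λ) (u₁ : Λ) (κ₁ : D) (u₂ : Λ) (κ₂ : D) (M : Fin 4 → Fin 4 → Fin 4 → Fin 4 → C → C → ℝ) (μ ν : D) (k l : Fin 4) :
    Matrix (Λ × (C × D)) (Λ × (C × D)) ℝ :=
  if dir μ ν k = κ₁ ∧ dir μ ν l = κ₂ ∧ u₁ - off e μ ν k + off e μ ν l = u₂ then
    plaqMat e (u₁ - off e μ ν k) μ ν (fun i j => M i j k l) else 0

/-- **THE TWO-BOND VERTEX** of a four-position colour kernel `M i j k l a b` (fluctuation positions/colours `(i,a), (j,b)`, background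
positions `k, l`): the sum of ALL plaquette cells `(μ, ν; k, l)` through the ordered bond pair `((u₁,κ₁),(u₂,κ₂))` — contact cells `k = l`
(one bond seen twice) included, all ordered direction pairs `(μ, ν)` included (the convention of `PlaquetteVertex2.jet22` /
`PlaquetteVertex2Stencil.hess22`).  ONE finite matrix on `Λ × (C × D)` for ANY additive lattice `Λ` (no finiteness needed).  A definition
asserting nothing. [folklore] -/
def bondPairMat (e : D → Λ) (u₁ : Λ) (κ₁ : D) (u₂ : Λ) (κ₂ : D) (M : Fin 4 → Fin 4 → Fin 4 → Fin 4 → C → C → ℝ) :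
    Matrix (Λ × (C × D)) (Λ × (C × D)) ℝ :=
  ∑ μ, ∑ ν, ∑ k : Fin 4, ∑ l : Fin 4, cell e u₁ κ₁ u₂ κ₂ M μ ν k l

/-- THE KRONECKER KERNEL of a colourless four-position table `T` and a colour matrix `A`: `(i,j,k,l,a,b) ↦ A a b · T i j k l`. [folklore] -/
def kronK (T : Fin 4 → Fin 4 → Fin 4 → Fin 4 → ℝ) (A : Matrix C C ℝ) : Fin 4 → Fin 4 → Fin 4 → Fin 4 → C → C → ℝ :=
  fun i j k l a b => A a b * T i j k l

/-- THE COLOURLESS PLAQUETTE STENCIL of a two-position table `T₂`: at the position pair `(i, j)` the entry `T₂ i j` in the direction slot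
`(dir i, dir j)`, sites `x + off i`, `x + off j`. [folklore] -/
def plaqTab (e : D → Λ) (x : Λ) (μ ν : D) (T₂ : Fin 4 → Fin 4 → ℝ) : Matrix (Λ × D) (Λ × D) ℝ :=
  stencilIns x Finset.univ (fun s : Fin 4 × Fin 4 => off e μ ν s.1) (fun s => off e μ ν s.2)
    fun s => T₂ s.1 s.2 • Matrix.single (dir μ ν s.1) (dir μ ν s.2) (1 : ℝ)

omit [Fintype D] in
/-- ENTRIES OF THE COLOURLESS PLAQUETTE STENCIL. [folklore] -/
theorem plaqTab_apply (e : D → Λ) (x : Λ) (μ ν : D) (T₂ : Fin 4 → Fin 4 → ℝ) (y y' : Λ) (α β : D) :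
    plaqTab e x μ ν T₂ (y, α) (y', β)
      = ∑ i, ∑ j, if y = x + off e μ ν i ∧ y' = x + off e μ ν j then (if α = dir μ ν i ∧ β = dir μ ν j then T₂ i j else 0) else 0 := by
  rw [plaqTab, stencilIns_apply, Fintype.sum_prod_type]
  refine Finset.sum_congr rfl fun i _ => Finset.sum_congr rfl fun j _ => ?_
  simp only [Matrix.smul_apply, Matrix.single_apply, smul_eq_mul, mul_ite, mul_one, mul_zero, @eq_comm _ (dir μ ν i) α,
    @eq_comm _ (dir μ ν j) β]

/-- THE COLOURLESS CELL. [folklore] -/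
def cellTab (e : D → Λ) (u₁ : Λ) (κ₁ : D) (u₂ : Λ) (κ₂ : D) (T : Fin 4 → Fin 4 → Fin 4 → Fin 4 → ℝ) (μ ν : D) (k l : Fin 4) :
    Matrix (Λ × D) (Λ × D) ℝ :=
  if dir μ ν k = κ₁ ∧ dir μ ν l = κ₂ ∧ u₁ - off e μ ν k + off e μ ν l = u₂ then
    plaqTab e (u₁ - off e μ ν k) μ ν (fun i j => T i j k l) else 0

/-- **THE COLOURLESS TWO-BOND TABLE** of a four-position table `T`: ONE matrix on `Λ × D`. A definition asserting nothing. [folklore] -/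
def bondPairTab (e : D → Λ) (u₁ : Λ) (κ₁ : D) (u₂ : Λ) (κ₂ : D) (T : Fin 4 → Fin 4 → Fin 4 → Fin 4 → ℝ) : Matrix (Λ × D) (Λ × D) ℝ :=
  ∑ μ, ∑ ν, ∑ k : Fin 4, ∑ l : Fin 4, cellTab e u₁ κ₁ u₂ κ₂ T μ ν k l

omit [DecidableEq Λ] [AddCommGroup Λ] [Fintype D] [DecidableEq D] in
/-- entries of a conditional matrix. [folklore] -/
theorem ite_apply₂ {m n : Type*} (P : Prop) [Decidable P] (M : Matrix m n ℝ) (p : m) (q : n) :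
    (if P then M else (0 : Matrix m n ℝ)) p q = if P then M p q else 0 := by
  split_ifs <;> rfl

omit [Fintype D] in
/-- **THE KRONECKER READING, PER PLAQUETTE**: `plaqMat (A ⊗ T₂) (y,(a,α)) (y′,(b,β)) = A a b · plaqTab T₂ (y,α) (y′,β)`. [folklore] -/
theorem plaqMat_kron_apply (e : D → Λ) (x : Λ) (μ ν : D) (T₂ : Fin 4 → Fin 4 → ℝ) (A : Matrix C C ℝ) (y y' : Λ) (a b : C)
    (α β : D) :
    plaqMat e x μ ν (fun i j a b => A a b * T₂ i j) (y, (a, α)) (y', (b, β)) = A a b * plaqTab e x μ ν T₂ (y, α) (y', β) := by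
  rw [plaqMat_apply, plaqTab_apply, Finset.mul_sum]
  refine Finset.sum_congr rfl fun i _ => ?_
  rw [Finset.mul_sum]
  refine Finset.sum_congr rfl fun j _ => ?_
  split_ifs <;> simp

/-- **THE KRONECKER READING OF THE TWO-BOND VERTEX**: `bondPairMat (A ⊗ T) (y,(a,α)) (y′,(b,β)) = A a b · bondPairTab T (y,α) (y′,β)` —
colour matrix times the colourless two-bond table, entrywise. [folklore] -/
theorem bondPairMat_kron_apply (e : D → Λ) (u₁ : Λ) (κ₁ : D) (u₂ : Λ) (κ₂ : D) (T : Fin 4 → Fin 4 → Fin 4 → Fin 4 → ℝ)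
    (A : Matrix C C ℝ) (y y' : Λ) (a b : C) (α β : D) :
    bondPairMat e u₁ κ₁ u₂ κ₂ (kronK T A) (y, (a, α)) (y', (b, β)) = A a b * bondPairTab e u₁ κ₁ u₂ κ₂ T (y, α) (y', β) := by
  simp only [bondPairMat, bondPairTab, Matrix.sum_apply, Finset.mul_sum]
  refine Finset.sum_congr rfl fun μ _ => Finset.sum_congr rfl fun ν _ => Finset.sum_congr rfl fun k _ =>
    Finset.sum_congr rfl fun l _ => ?_
  rw [cell, cellTab, ite_apply₂, ite_apply₂]
  split_ifs with h
  · exact plaqMat_kron_apply e _ μ ν _ A y y' a b α β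
  · rw [mul_zero]

/-- **THE `C := Unit, A := 1` READING IS THE COLOURLESS TABLE**:
`bondPairTab T (y,α) (y′,β) = bondPairMat (C := Unit) (kronK T 1) (y,((),α)) (y′,((),β))` — the reading an2 takes on `ℤ^{d+1}`. [folklore] -/
theorem bondPairTab_apply_eq_unit (e : D → Λ) (u₁ : Λ) (κ₁ : D) (u₂ : Λ) (κ₂ : D) (T : Fin 4 → Fin 4 → Fin 4 → Fin 4 → ℝ)
    (y y' : Λ) (α β : D) :
    bondPairTab e u₁ κ₁ u₂ κ₂ T (y, α) (y', β)
      = bondPairMat (C := Unit) e u₁ κ₁ u₂ κ₂ (kronK T (1 : Matrix Unit Unit ℝ)) (y, ((), α)) (y', ((), β)) := by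
  rw [bondPairMat_kron_apply, Matrix.one_apply_eq, one_mul]

/-- **AT SECOND ORDER, PER WORD, THE `A := 1` COLOUR STRIPPING LOSES NOTHING**:
`bondPairMat (A ⊗ T) (y,(a,α)) (y′,(b,β)) = A a b · bondPairMat (1 ⊗ T) (y,((),α)) (y′,((),β))`. [folklore] -/
theorem bondPairMat_kron_apply_eq_mul_unit (e : D → Λ) (u₁ : Λ) (κ₁ : D) (u₂ : Λ) (κ₂ : D) (T : Fin 4 → Fin 4 → Fin 4 → Fin 4 → ℝ)
    (A : Matrix C C ℝ) (y y' : Λ) (a b : C) (α β : D) :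
    bondPairMat e u₁ κ₁ u₂ κ₂ (kronK T A) (y, (a, α)) (y', (b, β))
      = A a b * bondPairMat (C := Unit) e u₁ κ₁ u₂ κ₂ (kronK T (1 : Matrix Unit Unit ℝ)) (y, ((), α)) (y', ((), β)) := by
  rw [bondPairMat_kron_apply, bondPairTab_apply_eq_unit]

end TwoBond

/-! ## §3 Linearity in the kernel; the word decomposition of the two-bond vertex -/

section Linear

variable {Λ : Type*} [DecidableEq Λ] [AddCommGroup Λ] {C : Type*} {D : Type*} [Fintype D] [DecidableEq D]

omit [Fintype D] in
/-- the plaquette stencil is ADDITIVE in its kernel. [folklore] -/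
theorem plaqMat_add (e : D → Λ) (x : Λ) (μ ν : D) (M M' : Fin 4 → Fin 4 → C → C → ℝ) :
    plaqMat e x μ ν (fun i j a b => M i j a b + M' i j a b) = plaqMat e x μ ν M + plaqMat e x μ ν M' := by
  ext ⟨y, a, α⟩ ⟨y', b, β⟩
  simp only [Matrix.add_apply, plaqMat_apply, ← Finset.sum_add_distrib]
  refine Finset.sum_congr rfl fun i _ => Finset.sum_congr rfl fun j _ => ?_
  split_ifs <;> simp

omit [Fintype D] in
/-- the plaquette stencil is HOMOGENEOUS in its kernel. [folklore] -/
theorem plaqMat_smul (e : D → Λ) (x : Λ) (μ ν : D) (r : ℝ) (M : Fin 4 → Fin 4 → C → C → ℝ) :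
    plaqMat e x μ ν (fun i j a b => r * M i j a b) = r • plaqMat e x μ ν M := by
  ext ⟨y, a, α⟩ ⟨y', b, β⟩
  simp only [Matrix.smul_apply, plaqMat_apply, smul_eq_mul, Finset.mul_sum]
  refine Finset.sum_congr rfl fun i _ => Finset.sum_congr rfl fun j _ => ?_
  split_ifs <;> simp

omit [Fintype D] in
/-- the plaquette stencil of the zero kernel vanishes. [folklore] -/
theorem plaqMat_zero (e : D → Λ) (x : Λ) (μ ν : D) : plaqMat e x μ ν (fun _ _ (_ _ : C) => (0 : ℝ)) = 0 := by
  ext ⟨y, a, α⟩ ⟨y', b, β⟩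
  simp only [Matrix.zero_apply, plaqMat_apply]
  exact Finset.sum_eq_zero fun i _ => Finset.sum_eq_zero fun j _ => by split_ifs <;> rfl

omit [Fintype D] in
/-- the plaquette stencil of a FINITE SUM of kernels. [folklore] -/
theorem plaqMat_finset_sum {ι : Type*} (S : Finset ι) (e : D → Λ) (x : Λ) (μ ν : D) (M : ι → Fin 4 → Fin 4 → C → C → ℝ) :
    plaqMat e x μ ν (fun i j a b => ∑ w ∈ S, M w i j a b) = ∑ w ∈ S, plaqMat e x μ ν (M w) := by
  classical
  induction S using Finset.induction_on with
  | empty => simpa using plaqMat_zero (C := C) e x μ ν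
  | insert w S hw ih =>
    simp only [Finset.sum_insert hw]
    rw [← ih, ← plaqMat_add]

/-- the two-bond vertex is ADDITIVE in its kernel. [folklore] -/
theorem bondPairMat_add (e : D → Λ) (u₁ : Λ) (κ₁ : D) (u₂ : Λ) (κ₂ : D) (M M' : Fin 4 → Fin 4 → Fin 4 → Fin 4 → C → C → ℝ) :
    bondPairMat e u₁ κ₁ u₂ κ₂ (fun i j k l a b => M i j k l a b + M' i j k l a b)
      = bondPairMat e u₁ κ₁ u₂ κ₂ M + bondPairMat e u₁ κ₁ u₂ κ₂ M' := by
  simp only [bondPairMat, ← Finset.sum_add_distrib]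
  refine Finset.sum_congr rfl fun μ _ => Finset.sum_congr rfl fun ν _ => Finset.sum_congr rfl fun k _ =>
    Finset.sum_congr rfl fun l _ => ?_
  simp only [cell]
  split_ifs with h
  · exact plaqMat_add e _ μ ν _ _
  · rw [add_zero]

/-- the two-bond vertex is HOMOGENEOUS in its kernel. [folklore] -/
theorem bondPairMat_smul (e : D → Λ) (u₁ : Λ) (κ₁ : D) (u₂ : Λ) (κ₂ : D) (r : ℝ) (M : Fin 4 → Fin 4 → Fin 4 → Fin 4 → C → C → ℝ) :
    bondPairMat e u₁ κ₁ u₂ κ₂ (fun i j k l a b => r * M i j k l a b) = r • bondPairMat e u₁ κ₁ u₂ κ₂ M := by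
  simp only [bondPairMat, Finset.smul_sum]
  refine Finset.sum_congr rfl fun μ _ => Finset.sum_congr rfl fun ν _ => Finset.sum_congr rfl fun k _ =>
    Finset.sum_congr rfl fun l _ => ?_
  simp only [cell]
  split_ifs with h
  · exact plaqMat_smul e _ μ ν r _
  · rw [smul_zero]

/-- the two-bond vertex of the zero kernel vanishes. [folklore] -/
theorem bondPairMat_zero (e : D → Λ) (u₁ : Λ) (κ₁ : D) (u₂ : Λ) (κ₂ : D) :
    bondPairMat e u₁ κ₁ u₂ κ₂ (fun _ _ _ _ (_ _ : C) => (0 : ℝ)) = 0 := by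
  simp only [bondPairMat]
  refine Finset.sum_eq_zero fun μ _ => Finset.sum_eq_zero fun ν _ => Finset.sum_eq_zero fun k _ =>
    Finset.sum_eq_zero fun l _ => ?_
  simp only [cell]
  split_ifs with h
  · exact plaqMat_zero (C := C) e _ μ ν
  · rfl

/-- the two-bond vertex of a FINITE SUM of kernels. [folklore] -/
theorem bondPairMat_finset_sum {ι : Type*} (S : Finset ι) (e : D → Λ) (u₁ : Λ) (κ₁ : D) (u₂ : Λ) (κ₂ : D)
    (M : ι → Fin 4 → Fin 4 → Fin 4 → Fin 4 → C → C → ℝ) :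
    bondPairMat e u₁ κ₁ u₂ κ₂ (fun i j k l a b => ∑ w ∈ S, M w i j k l a b) = ∑ w ∈ S, bondPairMat e u₁ κ₁ u₂ κ₂ (M w) := by
  classical
  induction S using Finset.induction_on with
  | empty => simpa using bondPairMat_zero (C := C) e u₁ κ₁ u₂ κ₂
  | insert w S hw ih =>
    simp only [Finset.sum_insert hw]
    rw [← ih, ← bondPairMat_add]

end Linear

section Vertex

variable {𝔸 : Type*} [NormedRing 𝔸] [NormedAlgebra ℝ 𝔸]
variable {Λ : Type*} [DecidableEq Λ] [AddCommGroup Λ] {C : Type*} {D : Type*} [Fintype D] [DecidableEq D]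

/-- THE `(2,2)` COLOUR KERNEL AT BACKGROUND COLOURS `(c, d)`: `(i,j,k,l,a,b) ↦ K22 τ t i j k l a b c d`. [folklore] -/
def K22ker (τ : 𝔸 →ₗ[ℝ] ℝ) (t : C → 𝔸) (c d : C) : Fin 4 → Fin 4 → Fin 4 → Fin 4 → C → C → ℝ :=
  fun i j k l a b => K22 τ t i j k l a b c d

/-- **THE WILSON TWO-BOND SECOND-ORDER VERTEX** at the ordered pair of background coordinates `p₁ = (u₁,(c,κ₁))`, `p₂ = (u₂,(d,κ₂))`: the
two-bond vertex of the `(2,2)` colour kernel at background colours `(c, d)` — the coefficient matrix of `u p₁ · u p₂` in the `B`-Hessian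
`hess22` at `B = field t u` (§4).  ONE finite matrix on `Λ × (C × D)` for any additive lattice `Λ`.  A definition asserting nothing.
[folklore] -/
def wilsonVertex₂ (τ : 𝔸 →ₗ[ℝ] ℝ) (t : C → 𝔸) (e : D → Λ) (p₁ p₂ : Λ × (C × D)) : Matrix (Λ × (C × D)) (Λ × (C × D)) ℝ :=
  bondPairMat e p₁.1 p₁.2.2 p₂.1 p₂.2.2 (K22ker τ t p₁.2.1 p₂.2.1)

/-- the `(2,2)` colour kernel at `(c,d)` is the `Fin 9`-sum of the Kronecker kernels `cmat_w(c,d) ⊗ stab_w`. [folklore] -/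
theorem K22ker_eq_sum_kronK (τ : 𝔸 →ₗ[ℝ] ℝ) (t : C → 𝔸) (c d : C) :
    K22ker τ t c d = fun i j k l a b => ∑ w ∈ Finset.univ, kronK (fun i j k l => stab i j k l w) (cmat τ t w c d) i j k l a b := by
  funext i j k l a b
  simp only [K22ker, kronK, K22_eq_sum_cmat, mul_comm (stab i j k l _)]

/-- **THE WORD DECOMPOSITION OF THE TWO-BOND VERTEX**: `wilsonVertex₂ = Σ_w bondPairMat (cmat_w(c,d) ⊗ stab_w)` — nine colourless
two-bond tables, each tensored with its colour word matrix. [folklore] -/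
theorem wilsonVertex₂_eq_sum_words (τ : 𝔸 →ₗ[ℝ] ℝ) (t : C → 𝔸) (e : D → Λ) (p₁ p₂ : Λ × (C × D)) :
    wilsonVertex₂ τ t e p₁ p₂
      = ∑ w, bondPairMat e p₁.1 p₁.2.2 p₂.1 p₂.2.2 (kronK (fun i j k l => stab i j k l w) (cmat τ t w p₁.2.1 p₂.2.1)) := by
  rw [wilsonVertex₂, K22ker_eq_sum_kronK, bondPairMat_finset_sum]

/-- **… ENTRYWISE**: `wilsonVertex₂ p₁ p₂ (y,(a,α)) (y′,(b,β)) = Σ_w cmat_w(c,d)_{ab} · bondPairTab stab_w (y,α) (y′,β)`. [folklore] -/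
theorem wilsonVertex₂_apply (τ : 𝔸 →ₗ[ℝ] ℝ) (t : C → 𝔸) (e : D → Λ) (p₁ p₂ : Λ × (C × D)) (y y' : Λ) (a b : C) (α β : D) :
    wilsonVertex₂ τ t e p₁ p₂ (y, (a, α)) (y', (b, β))
      = ∑ w, cmat τ t w p₁.2.1 p₂.2.1 a b * bondPairTab e p₁.1 p₁.2.2 p₂.1 p₂.2.2 (fun i j k l => stab i j k l w) (y, α) (y', β) := by
  rw [wilsonVertex₂_eq_sum_words, Matrix.sum_apply]
  exact Finset.sum_congr rfl fun w _ => bondPairMat_kron_apply e _ _ _ _ _ _ y y' a b α β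

end Vertex

/-! ## §4 Headline: on a finite torus the `B`-Hessian `hess22` at `B = field t u` is `Σ_{p₁,p₂} u p₁ u p₂ • wilsonVertex₂ p₁ p₂` -/

section Reindex

variable {Λ : Type*} [Fintype Λ] [DecidableEq Λ] [AddCommGroup Λ] {C : Type*} [Fintype C] {D : Type*} [Fintype D] [DecidableEq D]
variable {V : Type*} [AddCommGroup V] [Module ℝ V]

omit [DecidableEq Λ] [AddCommGroup Λ] in
/-- delta collapse of a coordinate sum on a prescribed direction: `Σ_p u p • [κ₀ = p.dir]·H p.site p.colour = Σ_y Σ_c u (y,(c,κ₀)) • H y c`.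
[folklore] -/
theorem sum_coord_dir (u : Λ × (C × D) → ℝ) (κ₀ : D) (H : Λ → C → V) :
    ∑ p : Λ × (C × D), u p • (if κ₀ = p.2.2 then H p.1 p.2.1 else 0) = ∑ y, ∑ c, u (y, (c, κ₀)) • H y c := by
  rw [Fintype.sum_prod_type]
  refine Finset.sum_congr rfl fun y _ => ?_
  rw [Fintype.sum_prod_type]
  refine Finset.sum_congr rfl fun c _ => ?_
  rw [Finset.sum_eq_single_of_mem κ₀ (Finset.mem_univ _) fun κ _ hκ => by rw [if_neg (Ne.symm hκ), smul_zero]]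
  rw [if_pos rfl]

omit [AddCommGroup Λ] in
/-- delta collapse of a coordinate sum on a prescribed direction AND site: `Σ_p u p • [κ₀ = p.dir ∧ y₀ = p.site]·H p.colour = Σ_d u (y₀,(d,κ₀)) • H d`.
[folklore] -/
theorem sum_coord_dir_site (u : Λ × (C × D) → ℝ) (κ₀ : D) (y₀ : Λ) (H : C → V) :
    ∑ p : Λ × (C × D), u p • (if κ₀ = p.2.2 ∧ y₀ = p.1 then H p.2.1 else 0) = ∑ d, u (y₀, (d, κ₀)) • H d := by
  rw [Fintype.sum_prod_type,
    Finset.sum_eq_single_of_mem y₀ (Finset.mem_univ _) fun y _ hy => Finset.sum_eq_zero fun q _ => by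
      rw [if_neg (fun h => hy h.2.symm), smul_zero]]
  rw [Fintype.sum_prod_type]
  refine Finset.sum_congr rfl fun d _ => ?_
  rw [Finset.sum_eq_single_of_mem κ₀ (Finset.mem_univ _) fun κ _ hκ => by rw [if_neg (fun h => hκ h.1.symm), smul_zero]]
  rw [if_pos ⟨rfl, rfl⟩]

/-- **THE CELL RE-INDEXING** at fixed directions `(μ, ν)` and positions `(k, l)`: summing the background coordinates at positions `k, l` over
all base points `x` is summing over ordered pairs of background coordinates `p₁, p₂` with the cell condition. [folklore] -/
theorem reindex_cell (e : D → Λ) (u : Λ × (C × D) → ℝ) (μ ν : D) (k l : Fin 4) (Φ : Λ → C → C → V) :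
    ∑ x, ∑ c, ∑ d, (cv e u x μ ν k c * cv e u x μ ν l d) • Φ x c d
      = ∑ p₁ : Λ × (C × D), ∑ p₂ : Λ × (C × D), (u p₁ * u p₂) •
          (if dir μ ν k = p₁.2.2 ∧ dir μ ν l = p₂.2.2 ∧ p₁.1 - off e μ ν k + off e μ ν l = p₂.1 then
            Φ (p₁.1 - off e μ ν k) p₁.2.1 p₂.2.1 else 0) := by
  -- push `u p₂` inside and isolate the `p₁`-condition
  have h1 : ∀ p₁ p₂ : Λ × (C × D),
      (u p₁ * u p₂) • (if dir μ ν k = p₁.2.2 ∧ dir μ ν l = p₂.2.2 ∧ p₁.1 - off e μ ν k + off e μ ν l = p₂.1 then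
          Φ (p₁.1 - off e μ ν k) p₁.2.1 p₂.2.1 else 0)
        = u p₁ • (if dir μ ν k = p₁.2.2 then
            u p₂ • (if dir μ ν l = p₂.2.2 ∧ p₁.1 - off e μ ν k + off e μ ν l = p₂.1 then Φ (p₁.1 - off e μ ν k) p₁.2.1 p₂.2.1 else 0)
          else 0) := by
    intro p₁ p₂
    by_cases hA : dir μ ν k = p₁.2.2
    · simp only [hA, true_and, if_true, mul_smul]
    · simp only [hA, false_and, if_false, smul_zero]
  simp_rw [h1, ← Finset.smul_sum]
  have h2 : ∀ p₁ : Λ × (C × D),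
      (∑ p₂ : Λ × (C × D), if dir μ ν k = p₁.2.2 then
          u p₂ • (if dir μ ν l = p₂.2.2 ∧ p₁.1 - off e μ ν k + off e μ ν l = p₂.1 then Φ (p₁.1 - off e μ ν k) p₁.2.1 p₂.2.1 else 0)
        else 0)
        = if dir μ ν k = p₁.2.2 then ∑ d, u (p₁.1 - off e μ ν k + off e μ ν l, (d, dir μ ν l)) • Φ (p₁.1 - off e μ ν k) p₁.2.1 d
          else 0 := by
    intro p₁
    split_ifs with hA
    · exact sum_coord_dir_site u (dir μ ν l) _ _
    · simp
  simp_rw [h2]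
  rw [sum_coord_dir u (dir μ ν k) fun y c => ∑ d, u (y - off e μ ν k + off e μ ν l, (d, dir μ ν l)) • Φ (y - off e μ ν k) c d]
  -- re-index the base point `y = x + off k`
  refine Fintype.sum_equiv (Equiv.addRight (off e μ ν k)) _ _ fun x => ?_
  simp only [Equiv.coe_addRight, add_sub_cancel_right, Finset.smul_sum, ← mul_smul, cv_eq]

/-- **THE RE-INDEXING BY BOND PAIRS** at fixed directions `(μ, ν)`: `Σ_x Σ_{k,l} Σ_{c,d} u_k(c) u_l(d) • Φ = Σ_{p₁,p₂} u p₁ u p₂ • Σ_{k,l} [cell]·Φ`.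
[folklore] -/
theorem reindex_bondPairs (e : D → Λ) (u : Λ × (C × D) → ℝ) (μ ν : D) (Φ : Λ → Fin 4 → Fin 4 → C → C → V) :
    ∑ x, ∑ k, ∑ l, ∑ c, ∑ d, (cv e u x μ ν k c * cv e u x μ ν l d) • Φ x k l c d
      = ∑ p₁ : Λ × (C × D), ∑ p₂ : Λ × (C × D), (u p₁ * u p₂) • ∑ k, ∑ l,
          (if dir μ ν k = p₁.2.2 ∧ dir μ ν l = p₂.2.2 ∧ p₁.1 - off e μ ν k + off e μ ν l = p₂.1 then
            Φ (p₁.1 - off e μ ν k) k l p₁.2.1 p₂.2.1 else 0) := by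
  -- left: `k, l` outermost
  conv_lhs => rw [Finset.sum_comm]
  conv_lhs => arg 2; ext k; rw [Finset.sum_comm]
  -- right: `k, l` outermost
  simp_rw [Finset.smul_sum]
  conv_rhs => arg 2; ext p₁; rw [Finset.sum_comm]; arg 2; ext k; rw [Finset.sum_comm]
  conv_rhs => rw [Finset.sum_comm]
  conv_rhs => arg 2; ext k; rw [Finset.sum_comm]
  exact Finset.sum_congr rfl fun k _ => Finset.sum_congr rfl fun l _ => reindex_cell e u μ ν k l fun x c d => Φ x k l c d

end Reindex

section Headline

variable {𝔸 : Type*} [NormedRing 𝔸] [NormedAlgebra ℝ 𝔸]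
variable {Λ : Type*} [Fintype Λ] [DecidableEq Λ] [AddCommGroup Λ] {C : Type*} [Fintype C] {D : Type*} [Fintype D] [DecidableEq D]

omit [Fintype Λ] [DecidableEq Λ] [Fintype D] [DecidableEq D] in
/-- the polarised kernel at a coordinate background as a finite linear combination of the `(c,d)`-kernels (`PlaquetteVertex2Polar.M22_field`).
[folklore] -/
theorem M22_field_eq_sum (τ : 𝔸 →ₗ[ℝ] ℝ) (t : C → 𝔸) (e : D → Λ) (u : Λ × (C × D) → ℝ) (x : Λ) (μ ν : D) :
    PlaquetteVertex2Coords.M22 τ t e (field t u) x μ ν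
      = fun i j a b => ∑ k ∈ Finset.univ, ∑ l, ∑ c, ∑ d, cv e u x μ ν k c * cv e u x μ ν l d * K22ker τ t c d i j k l a b := by
  funext i j a b
  simp only [PlaquetteVertex2Polar.M22_field, K22ker]

omit [Fintype Λ] [Fintype D] in
/-- the `(2,2)` plaquette matrix at a coordinate background as a combination of the `(c,d)`-cell matrices. [folklore] -/
theorem P22Mat_field_eq_sum (τ : 𝔸 →ₗ[ℝ] ℝ) (t : C → 𝔸) (e : D → Λ) (u : Λ × (C × D) → ℝ) (x : Λ) (μ ν : D) :
    PlaquetteVertex2Stencil.P22Mat τ t e (field t u) x μ ν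
      = ∑ k, ∑ l, ∑ c, ∑ d, (cv e u x μ ν k c * cv e u x μ ν l d) • plaqMat e x μ ν (fun i j => K22ker τ t c d i j k l) := by
  rw [PlaquetteVertex2Stencil.P22Mat, M22_field_eq_sum, plaqMat_finset_sum]
  refine Finset.sum_congr rfl fun k _ => ?_
  rw [plaqMat_finset_sum]
  refine Finset.sum_congr rfl fun l _ => ?_
  rw [plaqMat_finset_sum]
  refine Finset.sum_congr rfl fun c _ => ?_
  rw [plaqMat_finset_sum]
  refine Finset.sum_congr rfl fun d _ => ?_
  rw [← plaqMat_smul]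

/-- **HEADLINE — THE `B`-HESSIAN OF THE `(2,2)`-JET IS THE COORDINATE-WEIGHTED SUM OF THE TWO-BOND VERTICES**: on a finite torus, at the
background `B = field t u` in colour coordinates,
`hess22 τ t e (field t u) = Σ_{p₁} Σ_{p₂} (u p₁ · u p₂) • wilsonVertex₂ τ t e p₁ p₂` — an identity of matrices on `Λ × (C × D)` (any
algebra, any real-linear `τ`, any letters `t`). [folklore] -/
theorem hess22_field_eq_sum_wilsonVertex₂ (τ : 𝔸 →ₗ[ℝ] ℝ) (t : C → 𝔸) (e : D → Λ) (u : Λ × (C × D) → ℝ) :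
    PlaquetteVertex2Stencil.hess22 τ t e (field t u) = ∑ p₁ : Λ × (C × D), ∑ p₂ : Λ × (C × D), (u p₁ * u p₂) • wilsonVertex₂ τ t e p₁ p₂ := by
  simp only [PlaquetteVertex2Stencil.hess22, P22Mat_field_eq_sum, wilsonVertex₂, bondPairMat, cell]
  -- left: the direction sums outermost
  conv_lhs => rw [Finset.sum_comm]
  conv_lhs => arg 2; ext μ; rw [Finset.sum_comm]
  -- right: distribute the weight over the direction sums, then the direction sums outermost
  conv_rhs => arg 2; ext p₁; arg 2; ext p₂; rw [Finset.smul_sum]; arg 2; ext μ; rw [Finset.smul_sum]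
  conv_rhs => arg 2; ext p₁; rw [Finset.sum_comm]; arg 2; ext μ; rw [Finset.sum_comm]
  conv_rhs => rw [Finset.sum_comm]
  conv_rhs => arg 2; ext μ; rw [Finset.sum_comm]
  refine Finset.sum_congr rfl fun μ _ => Finset.sum_congr rfl fun ν _ => ?_
  exact reindex_bondPairs e u μ ν fun x k l c d => plaqMat e x μ ν fun i j => K22ker τ t c d i j k l

/-- **COROLLARY — THE `(2,2)`-JET IN COORDINATES THROUGH THE TWO-BOND VERTICES**:
`jet22 ℝ τ e (field t v) (field t u) = Σ_{p₁} Σ_{p₂} u p₁ · u p₂ · (v ⬝ᵥ wilsonVertex₂ τ t e p₁ p₂ *ᵥ v)` (τ tracial). [folklore] -/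
theorem jet22_field_field_eq_sum_wilsonVertex₂ (τ : 𝔸 →ₗ[ℝ] ℝ) (hτ : ∀ a b : 𝔸, τ (a * b) = τ (b * a)) (t : C → 𝔸) (e : D → Λ)
    (v u : Λ × (C × D) → ℝ) :
    jet22 ℝ τ e (field t v) (field t u)
      = ∑ p₁ : Λ × (C × D), ∑ p₂ : Λ × (C × D), u p₁ * u p₂ * (v ⬝ᵥ (wilsonVertex₂ τ t e p₁ p₂ *ᵥ v)) := by
  rw [PlaquetteVertex2Stencil.jet22_field_quadForm τ hτ, hess22_field_eq_sum_wilsonVertex₂]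
  simp only [Matrix.sum_mulVec, dotProduct_sum, Matrix.smul_mulVec, dotProduct_smul, smul_eq_mul]

end Headline

/-! ## §5 Sockets: finite range, co-plaquette support, translation covariance, colour-blind contact factorisation -/

section Sockets

variable {Λ : Type*} [DecidableEq Λ] [AddCommGroup Λ] {C : Type*} {D : Type*} [Fintype D] [DecidableEq D]

/-- FINITE RANGE (rows): an entry of the two-bond vertex whose row site is none of the `u₁ − off k + off i` vanishes. [folklore] -/
theorem bondPairMat_apply_eq_zero_of_row (e : D → Λ) (u₁ : Λ) (κ₁ : D) (u₂ : Λ) (κ₂ : D)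
    (M : Fin 4 → Fin 4 → Fin 4 → Fin 4 → C → C → ℝ) {p : Λ × (C × D)} (q : Λ × (C × D))
    (h : ∀ μ ν k i, p.1 ≠ u₁ - off e μ ν k + off e μ ν i) : bondPairMat e u₁ κ₁ u₂ κ₂ M p q = 0 := by
  simp only [bondPairMat, Matrix.sum_apply]
  refine Finset.sum_eq_zero fun μ _ => Finset.sum_eq_zero fun ν _ => Finset.sum_eq_zero fun k _ =>
    Finset.sum_eq_zero fun l _ => ?_
  rw [cell, ite_apply₂]
  split_ifs with hc
  · exact plaqMat_apply_eq_zero_of_row e _ μ ν _ q fun i => h μ ν k i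
  · rfl

/-- FINITE RANGE (columns): an entry of the two-bond vertex whose column site is none of the `u₁ − off k + off j` vanishes. [folklore] -/
theorem bondPairMat_apply_eq_zero_of_col (e : D → Λ) (u₁ : Λ) (κ₁ : D) (u₂ : Λ) (κ₂ : D)
    (M : Fin 4 → Fin 4 → Fin 4 → Fin 4 → C → C → ℝ) (p : Λ × (C × D)) {q : Λ × (C × D)}
    (h : ∀ μ ν k j, q.1 ≠ u₁ - off e μ ν k + off e μ ν j) : bondPairMat e u₁ κ₁ u₂ κ₂ M p q = 0 := by
  simp only [bondPairMat, Matrix.sum_apply]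
  refine Finset.sum_eq_zero fun μ _ => Finset.sum_eq_zero fun ν _ => Finset.sum_eq_zero fun k _ =>
    Finset.sum_eq_zero fun l _ => ?_
  rw [cell, ite_apply₂]
  split_ifs with hc
  · exact plaqMat_apply_eq_zero_of_col e _ μ ν _ p fun j => h μ ν k j
  · rfl

/-- CO-PLAQUETTE SUPPORT: if NO plaquette passes through the background bonds `⟨u₁, κ₁⟩` (at some position `k`) and `⟨u₂, κ₂⟩` (at some
position `l`), the two-bond vertex is the zero matrix. [folklore] -/
theorem bondPairMat_eq_zero_of_not_coplaquette (e : D → Λ) (u₁ : Λ) (κ₁ : D) (u₂ : Λ) (κ₂ : D)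
    (M : Fin 4 → Fin 4 → Fin 4 → Fin 4 → C → C → ℝ)
    (h : ∀ μ ν k l, dir μ ν k = κ₁ → dir μ ν l = κ₂ → u₁ - off e μ ν k + off e μ ν l ≠ u₂) :
    bondPairMat e u₁ κ₁ u₂ κ₂ M = 0 := by
  simp only [bondPairMat]
  refine Finset.sum_eq_zero fun μ _ => Finset.sum_eq_zero fun ν _ => Finset.sum_eq_zero fun k _ =>
    Finset.sum_eq_zero fun l _ => ?_
  rw [cell]
  split_ifs with hc
  · exact absurd hc.2.2 (h μ ν k l hc.1 hc.2.1)
  · rfl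

/-- TRANSLATION COVARIANCE: translating both background bonds by `a` translates the two-bond vertex of the SAME kernel (the kernel's
own covariance under `B ↦ B(· + a)` is not restated here). [folklore] -/
theorem bondPairMat_translate (e : D → Λ) (u₁ u₂ a : Λ) (κ₁ κ₂ : D) (M : Fin 4 → Fin 4 → Fin 4 → Fin 4 → C → C → ℝ)
    (p q : Λ × (C × D)) :
    bondPairMat e (u₁ + a) κ₁ (u₂ + a) κ₂ M p q = bondPairMat e u₁ κ₁ u₂ κ₂ M (p.1 - a, p.2) (q.1 - a, q.2) := by
  simp only [bondPairMat, Matrix.sum_apply]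
  refine Finset.sum_congr rfl fun μ _ => Finset.sum_congr rfl fun ν _ => Finset.sum_congr rfl fun k _ =>
    Finset.sum_congr rfl fun l _ => ?_
  rw [cell, cell, ite_apply₂, ite_apply₂, show u₁ + a - off e μ ν k + off e μ ν l = u₁ - off e μ ν k + off e μ ν l + a by abel,
    show u₁ + a - off e μ ν k = u₁ - off e μ ν k + a by abel, plaqMat_translate]
  simp only [add_left_inj]

/-- FINITE RANGE (rows) of the colourless two-bond table. [folklore] -/
theorem bondPairTab_apply_eq_zero_of_row (e : D → Λ) (u₁ : Λ) (κ₁ : D) (u₂ : Λ) (κ₂ : D) (T : Fin 4 → Fin 4 → Fin 4 → Fin 4 → ℝ)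
    {p : Λ × D} (q : Λ × D) (h : ∀ μ ν k i, p.1 ≠ u₁ - off e μ ν k + off e μ ν i) : bondPairTab e u₁ κ₁ u₂ κ₂ T p q = 0 := by
  obtain ⟨y, α⟩ := p
  obtain ⟨y', β⟩ := q
  rw [bondPairTab_apply_eq_unit]
  exact bondPairMat_apply_eq_zero_of_row e u₁ κ₁ u₂ κ₂ _ _ fun μ ν k i => h μ ν k i

/-- FINITE RANGE (columns) of the colourless two-bond table. [folklore] -/
theorem bondPairTab_apply_eq_zero_of_col (e : D → Λ) (u₁ : Λ) (κ₁ : D) (u₂ : Λ) (κ₂ : D) (T : Fin 4 → Fin 4 → Fin 4 → Fin 4 → ℝ)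
    (p : Λ × D) {q : Λ × D} (h : ∀ μ ν k j, q.1 ≠ u₁ - off e μ ν k + off e μ ν j) : bondPairTab e u₁ κ₁ u₂ κ₂ T p q = 0 := by
  obtain ⟨y, α⟩ := p
  obtain ⟨y', β⟩ := q
  rw [bondPairTab_apply_eq_unit]
  exact bondPairMat_apply_eq_zero_of_col e u₁ κ₁ u₂ κ₂ _ _ fun μ ν k j => h μ ν k j

/-- CO-PLAQUETTE SUPPORT of the colourless two-bond table. [folklore] -/
theorem bondPairTab_eq_zero_of_not_coplaquette (e : D → Λ) (u₁ : Λ) (κ₁ : D) (u₂ : Λ) (κ₂ : D)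
    (T : Fin 4 → Fin 4 → Fin 4 → Fin 4 → ℝ)
    (h : ∀ μ ν k l, dir μ ν k = κ₁ → dir μ ν l = κ₂ → u₁ - off e μ ν k + off e μ ν l ≠ u₂) :
    bondPairTab e u₁ κ₁ u₂ κ₂ T = 0 := by
  ext ⟨y, α⟩ ⟨y', β⟩
  rw [bondPairTab_apply_eq_unit, bondPairMat_eq_zero_of_not_coplaquette e u₁ κ₁ u₂ κ₂ _ h]
  rfl

/-- TRANSLATION COVARIANCE of the colourless two-bond table. [folklore] -/
theorem bondPairTab_translate (e : D → Λ) (u₁ u₂ a : Λ) (κ₁ κ₂ : D) (T : Fin 4 → Fin 4 → Fin 4 → Fin 4 → ℝ) (p q : Λ × D) :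
    bondPairTab e (u₁ + a) κ₁ (u₂ + a) κ₂ T p q = bondPairTab e u₁ κ₁ u₂ κ₂ T (p.1 - a, p.2) (q.1 - a, q.2) := by
  obtain ⟨y, α⟩ := p
  obtain ⟨y', β⟩ := q
  rw [bondPairTab_apply_eq_unit, bondPairTab_apply_eq_unit, bondPairMat_translate]

omit [Fintype D] in
/-- the colourless plaquette stencil is ADDITIVE in its table. [folklore] -/
theorem plaqTab_add (e : D → Λ) (x : Λ) (μ ν : D) (T₂ T₂' : Fin 4 → Fin 4 → ℝ) :
    plaqTab e x μ ν (fun i j => T₂ i j + T₂' i j) = plaqTab e x μ ν T₂ + plaqTab e x μ ν T₂' := by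
  ext ⟨y, α⟩ ⟨y', β⟩
  simp only [Matrix.add_apply, plaqTab_apply, ← Finset.sum_add_distrib]
  refine Finset.sum_congr rfl fun i _ => Finset.sum_congr rfl fun j _ => ?_
  split_ifs <;> simp

omit [Fintype D] in
/-- the colourless plaquette stencil is HOMOGENEOUS in its table. [folklore] -/
theorem plaqTab_smul (e : D → Λ) (x : Λ) (μ ν : D) (r : ℝ) (T₂ : Fin 4 → Fin 4 → ℝ) :
    plaqTab e x μ ν (fun i j => r * T₂ i j) = r • plaqTab e x μ ν T₂ := by
  ext ⟨y, α⟩ ⟨y', β⟩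
  simp only [Matrix.smul_apply, plaqTab_apply, smul_eq_mul, Finset.mul_sum]
  refine Finset.sum_congr rfl fun i _ => Finset.sum_congr rfl fun j _ => ?_
  split_ifs <;> simp

/-- the colourless two-bond table is ADDITIVE in its table. [folklore] -/
theorem bondPairTab_add (e : D → Λ) (u₁ : Λ) (κ₁ : D) (u₂ : Λ) (κ₂ : D) (T T' : Fin 4 → Fin 4 → Fin 4 → Fin 4 → ℝ) :
    bondPairTab e u₁ κ₁ u₂ κ₂ (fun i j k l => T i j k l + T' i j k l) = bondPairTab e u₁ κ₁ u₂ κ₂ T + bondPairTab e u₁ κ₁ u₂ κ₂ T' := by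
  simp only [bondPairTab, ← Finset.sum_add_distrib]
  refine Finset.sum_congr rfl fun μ _ => Finset.sum_congr rfl fun ν _ => Finset.sum_congr rfl fun k _ =>
    Finset.sum_congr rfl fun l _ => ?_
  simp only [cellTab]
  split_ifs with h
  · exact plaqTab_add e _ μ ν _ _
  · rw [add_zero]

/-- the colourless two-bond table is HOMOGENEOUS in its table. [folklore] -/
theorem bondPairTab_smul (e : D → Λ) (u₁ : Λ) (κ₁ : D) (u₂ : Λ) (κ₂ : D) (r : ℝ) (T : Fin 4 → Fin 4 → Fin 4 → Fin 4 → ℝ) :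
    bondPairTab e u₁ κ₁ u₂ κ₂ (fun i j k l => r * T i j k l) = r • bondPairTab e u₁ κ₁ u₂ κ₂ T := by
  simp only [bondPairTab, Finset.smul_sum]
  refine Finset.sum_congr rfl fun μ _ => Finset.sum_congr rfl fun ν _ => Finset.sum_congr rfl fun k _ =>
    Finset.sum_congr rfl fun l _ => ?_
  simp only [cellTab]
  split_ifs with h
  · exact plaqTab_smul e _ μ ν r _
  · rw [smul_zero]

/-- the colourless two-bond table of the zero table vanishes. [folklore] -/
theorem bondPairTab_zero (e : D → Λ) (u₁ : Λ) (κ₁ : D) (u₂ : Λ) (κ₂ : D) :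
    bondPairTab e u₁ κ₁ u₂ κ₂ (fun _ _ _ _ => (0 : ℝ)) = 0 := by
  have h := bondPairTab_smul e u₁ κ₁ u₂ κ₂ 0 fun _ _ _ _ => (0 : ℝ)
  simpa using h

/-- the colourless two-bond table of a FINITE SUM of tables. [folklore] -/
theorem bondPairTab_finset_sum {ι : Type*} (S : Finset ι) (e : D → Λ) (u₁ : Λ) (κ₁ : D) (u₂ : Λ) (κ₂ : D)
    (T : ι → Fin 4 → Fin 4 → Fin 4 → Fin 4 → ℝ) :
    bondPairTab e u₁ κ₁ u₂ κ₂ (fun i j k l => ∑ w ∈ S, T w i j k l) = ∑ w ∈ S, bondPairTab e u₁ κ₁ u₂ κ₂ (T w) := by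
  classical
  induction S using Finset.induction_on with
  | empty => simpa using bondPairTab_zero e u₁ κ₁ u₂ κ₂
  | insert w S hw ih =>
    simp only [Finset.sum_insert hw]
    rw [← ih, ← bondPairTab_add]

/-- **THE PLAQUETTE WEIGHT TABLE DECOMPOSES OVER THE WORDS**: `bondPairTab (w22 N) = Σ_w κ_w(N) • bondPairTab stab_w`. [folklore] -/
theorem bondPairTab_w22_eq_sum (N : ℕ) (e : D → Λ) (u₁ : Λ) (κ₁ : D) (u₂ : Λ) (κ₂ : D) :
    bondPairTab e u₁ κ₁ u₂ κ₂ (w22 N) = ∑ w, kap N w • bondPairTab e u₁ κ₁ u₂ κ₂ (fun i j k l => stab i j k l w) := by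
  have hw : w22 N = fun i j k l => ∑ w ∈ Finset.univ, kap N w * stab i j k l w := by
    funext i j k l
    exact w22_eq_sum_kap N i j k l
  rw [hw, bondPairTab_finset_sum]
  exact Finset.sum_congr rfl fun w _ => bondPairTab_smul e u₁ κ₁ u₂ κ₂ (kap N w) _

end Sockets

section Contact

variable {Λ : Type*} [Fintype Λ] [DecidableEq Λ] [AddCommGroup Λ] {C : Type*} [Fintype C] [DecidableEq C]
  {D : Type*} [Fintype D] [DecidableEq D]

/-- **COLOUR-BLIND CONTACT FACTORISATION, PER PLAQUETTE**: against colour-blind legs `1_C ⊗ G` the contact term of the plaquette stencil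
of a Kronecker kernel `A ⊗ T₂` is `trace A` times the colourless contact term of `T₂`. [folklore] -/
theorem trace_cbLeg_mul_plaqMat_kron (G : Λ → Matrix D D ℝ) (e : D → Λ) (x : Λ) (μ ν : D) (T₂ : Fin 4 → Fin 4 → ℝ)
    (A : Matrix C C ℝ) :
    Matrix.trace (mconvKernel (cbLeg G) * plaqMat e x μ ν (fun i j a b => A a b * T₂ i j))
      = Matrix.trace A * Matrix.trace (mconvKernel G * plaqTab e x μ ν T₂) := by
  rw [trace_mconvKernel_mul_plaqMat, plaqTab, contact_stencil_m, Fintype.sum_prod_type, Finset.mul_sum]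
  refine Finset.sum_congr rfl fun i _ => ?_
  rw [Finset.mul_sum]
  refine Finset.sum_congr rfl fun j _ => ?_
  rw [trace_cbLeg_mul_dirBlock]
  simp only [Matrix.of_apply, Matrix.mul_smul, Matrix.trace_smul, Matrix.trace_mul_single, MulOpposite.op_one, one_smul,
    smul_eq_mul, ← Finset.sum_mul]
  simp only [Matrix.trace, Matrix.diag_apply]
  ring

/-- **COLOUR-BLIND CONTACT FACTORISATION OF THE TWO-BOND VERTEX**: `trace ((1 ⊗ G)-legs · bondPairMat (A ⊗ T)) = trace A · trace (G-legs ·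
bondPairTab T)` — the colour trace factors off, per word. [folklore] -/
theorem trace_cbLeg_mul_bondPairMat_kron (G : Λ → Matrix D D ℝ) (e : D → Λ) (u₁ : Λ) (κ₁ : D) (u₂ : Λ) (κ₂ : D)
    (T : Fin 4 → Fin 4 → Fin 4 → Fin 4 → ℝ) (A : Matrix C C ℝ) :
    Matrix.trace (mconvKernel (cbLeg G) * bondPairMat e u₁ κ₁ u₂ κ₂ (kronK T A))
      = Matrix.trace A * Matrix.trace (mconvKernel G * bondPairTab e u₁ κ₁ u₂ κ₂ T) := by
  simp only [bondPairMat, bondPairTab, Matrix.trace_sum, Finset.mul_sum]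
  refine Finset.sum_congr rfl fun μ _ => Finset.sum_congr rfl fun ν _ => Finset.sum_congr rfl fun k _ =>
    Finset.sum_congr rfl fun l _ => ?_
  simp only [cell, cellTab]
  split_ifs with h
  · exact trace_cbLeg_mul_plaqMat_kron G e _ μ ν _ A
  · simp

variable {N : ℕ}

attribute [local instance] Matrix.linftyOpNormedRing Matrix.linftyOpNormedAlgebra

/-- **THE COLOUR-BLIND TWO-BOND TADPOLE IN BAŁABAN'S LETTERS** (`τ = rntr`, letters `gen τ` of a complete trace-orthonormal family in
`𝔰𝔲(N)`, `N ≠ 0`): `trace ((1 ⊗ G)-legs · wilsonVertex₂ p₁ p₂) = [c = d] · trace (G-legs · bondPairTab (w22 N))` — ONE colourless table,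
the plaquette weight table `w22 N` of `PlaquetteVertex2Words`, diagonal in the background colours. [folklore] -/
theorem trace_cbLeg_mul_wilsonVertex₂_gen {τ : C → Matrix (Fin N) (Fin N) ℂ} (hτ : Complete τ) (ho : TrOrthonormal τ) (hN : N ≠ 0)
    (G : Λ → Matrix D D ℝ) (e : D → Λ) (p₁ p₂ : Λ × (C × D)) :
    Matrix.trace (mconvKernel (cbLeg G) * wilsonVertex₂ rntr (gen τ) e p₁ p₂)
      = if p₁.2.1 = p₂.2.1 then Matrix.trace (mconvKernel G * bondPairTab e p₁.1 p₁.2.2 p₂.1 p₂.2.2 (w22 N)) else 0 := by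
  rw [wilsonVertex₂_eq_sum_words, Matrix.mul_sum, Matrix.trace_sum]
  simp_rw [trace_cbLeg_mul_bondPairMat_kron, trace_cmat_gen hτ ho hN]
  split_ifs with hcd
  · rw [bondPairTab_w22_eq_sum, Matrix.mul_sum, Matrix.trace_sum]
    exact Finset.sum_congr rfl fun w _ => by rw [Matrix.mul_smul, Matrix.trace_smul, smul_eq_mul]
  · simp

end Contact

/-! ## §6 Examples (kernel-checked sanity) -/

section Examples

/-- the gate opens exactly on increasing position pairs. -/
example : gate 0 1 = 1 ∧ gate 1 0 = 0 ∧ gate 2 2 = 0 := by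
  refine ⟨?_, ?_, ?_⟩ <;> simp [gate]

/-- the `A := 1` Kronecker kernel on `C := Unit` is the table itself. -/
example (T : Fin 4 → Fin 4 → Fin 4 → Fin 4 → ℝ) (i j k l : Fin 4) : kronK T (1 : Matrix Unit Unit ℝ) i j k l () () = T i j k l := by
  simp [kronK]

/-- the nine weights in Bałaban's letters sum to `(N² − 1)/2`. -/
example (N : ℕ) : ∑ w, kap N w = 2⁻¹ * ((N : ℝ) ^ 2 - 1) := by
  simp only [Fin.sum_univ_succ, Fin.sum_univ_zero, kap, Matrix.cons_val_zero, Matrix.cons_val_succ]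
  ring

/-- CO-PLAQUETTE SUPPORT, decided: on `ℤ²` with the unit steps, no plaquette passes through a bond at the origin and a bond at `(5,5)`,
so the colourless two-bond table of ANY four-position table vanishes there. -/
example (T : Fin 4 → Fin 4 → Fin 4 → Fin 4 → ℝ) (κ₁ κ₂ : Fin 2) :
    bondPairTab (![((1 : ℤ), (0 : ℤ)), (0, 1)] : Fin 2 → ℤ × ℤ) (0, 0) κ₁ (5, 5) κ₂ T = 0 := by
  have h : ∀ (μ ν : Fin 2) (k l : Fin 4),
      ((0 : ℤ), (0 : ℤ)) - off (![((1 : ℤ), (0 : ℤ)), (0, 1)] : Fin 2 → ℤ × ℤ) μ ν k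
        + off (![((1 : ℤ), (0 : ℤ)), (0, 1)] : Fin 2 → ℤ × ℤ) μ ν l ≠ (5, 5) := by
    decide
  exact bondPairTab_eq_zero_of_not_coplaquette _ _ _ _ _ T fun μ ν k l _ _ => h μ ν k l

end Examples

end Literature.MathematicalPhysics.QuantumFieldTheory.Balaban1983to89.Beta.WilsonVertex2Kron
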